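import Literature.AnabelianGeometry.Anabelioids.Basic
import HarnessLib

/-!
# Anabelioids: named facts of `Anabelioids/Basic.lean`, IV — relative slimness ⇒ slim source

Mochizuki, *The geometry of anabelioids*, Publ. RIMS **40** (2004), §1.2, Remark 1.2.9.1, author's
manuscript p. 24 [cite: MochizukiGeoAn2004, Rem. 1.2.9.1 p.24], fourth assertion: "If `U → V` is a
relatively slim morphism between connected anabelioids … if, moreover, `U → V` is a
`π₁`-monomorphism, then it follows that `U` is also slim."  The statement file
`Literature.AnabelianGeometry.Anabelioids.Basic` records it as the named fact
`isSlim_source_of_isRelativelySlim_of_isPi1Mono` (abc-iut cell node `GeoAn:Rmk1.2.9.1`,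
fourth claim); this proof-only companion discharges it AS TYPED.

Proof.  For a basepoint `β` of `X` the homomorphism `π₁(φ) : π₁(X, β) → π₁(Y, φ ∘ β)`
is injective (`π₁`-monomorphism) and relatively slim.  If `z ∈ π₁(X, β)` centralizes an open
subgroup `U`, then `π₁(φ)(z)` centralizes `π₁(φ)(U)`, hence is trivial by relative slimness, hence
`z = 1` by injectivity.  (No basepoint comparison is needed: the hypotheses are given at every
basepoint of `X`.)  Proof-only file: no definitions; nothing of the statement file is restated.
-/

namespace Literature.AnabelianGeometry.Anabelioids

open CategoryTheory CategoryTheory.PreGaloisCategory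

universe v₁ v₂ u₁ u₂

/-- **[GeoAn] Remark 1.2.9.1, fourth assertion** (p. 24): a relatively slim `π₁`-monomorphism
`φ : X → Y` of connected anabelioids has slim source — the named fact
`isSlim_source_of_isRelativelySlim_of_isPi1Mono` HOLDS.
[cite: MochizukiGeoAn2004, Rem. 1.2.9.1 p.24] -/
theorem isSlim_source_of_isRelativelySlim_of_isPi1Mono_holds :
    isSlim_source_of_isRelativelySlim_of_isPi1Mono.{v₁, v₂, u₁, u₂} := by
  intro X _ Y _ _ _ φ hslim hmono
  refine ⟨fun F _ => ⟨fun U hU => ?_⟩⟩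
  have hcen := (hslim F).centralizer_eq_bot U hU
  rw [eq_bot_iff] at hcen ⊢
  intro z hz
  rw [Subgroup.mem_bot]
  apply hmono F
  rw [map_one, ← Subgroup.mem_bot]
  apply hcen
  rw [Subgroup.mem_centralizer_iff]
  rintro _ ⟨u, hu, rfl⟩
  rw [← map_mul, ← map_mul, (Subgroup.mem_centralizer_iff.mp hz) u hu]

end Literature.AnabelianGeometry.Anabelioids
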